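import Summits.QuantumFields.BalabanUV.T4Continuum.Support.NE3SmoothLiftFlat
import Summits.QuantumFields.BalabanUV.T4Continuum.Support.NE3FramePotGauge
import Summits.QuantumFields.BalabanUV.T4Continuum.Support.NE3TangentFlatStructure
import Summits.QuantumFields.BalabanUV.T4Continuum.Support.NE3CoarseInterpolant
import Summits.QuantumFields.BalabanUV.T4Continuum.Support.ReplicationRightInverse
import HarnessLib

/-!
# T⁴ programme, node NE3 — route Π, row Π-R («SMOOTH RIGHT INVERSE», D-ne3p1-g24-1 §6), file Π-R♭-3: THE EXACT, LOCAL, SMOOTH RIGHT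
# INVERSE OF THE LINEARISED k-FOLD AVERAGE AT THE FLAT BACKGROUND — `cpushIter L j 1 (smoothRightInverse L j φ) = φ`

NE3 (node U1b) formalisation swarm, leaf seat `b2b-balaban-t4-ne3-formalise-leaf-01` (gen 7); design finding D-ne3leaf01g7-1 (`HOME/CLAIMS.log` l.21412,
memo `HOME/b2b-balaban-t4-ne3-formalise-leaf-01/g7/PI-R-DESIGN-leaf01g7.md` v2).  THE MECHANISM (all BY NAME): at the flat background the
`(j+1)`-fold push-forward is the `(j+1)`-fold iterate of the contour average (`NE3TangentNoGoFlat.cpush_flat`, `cavg_flat`), which is the straight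
`(j+1)`-fold average minus the coboundary of the accumulated frame potential (`NE3TangentFlatStructure.iterate_Tcoarse_eq`:
`(Tcoarse L)^[k] Y = (Qcoarse L)^[k] Y − dPot (framePot L k Y)`); the straight k-fold average is the single-scale straight-line average over
`M = L^k`-blocks (Literature `B7Prop4Flat.linQIter_eq_linQ_pow`), which reproduces the datum from the smooth lift (Π-R♭-2
`NE3SmoothLiftFlat.linQ_smoothLift`); and the contour average maps a coboundary to the coboundary of the corner-restricted potential
(`NE3FramePotGauge.iterate_Tcoarse_dPot`).  Hence **`smoothRightInverse L j φ := smoothLift M φ + dPot (interp M univ (framePot L (j+1) (smoothLift M φ)))`**,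
`M = L^{j+1}`: the smooth lift plus the CURL-FREE pure-gauge corrector interpolating the frame potential (H3 `NE3CoarseInterpolant.interp_corner`), and
**`cpushIter_flat_smoothRightInverse : cpushIter L j 1 (smoothRightInverse L j φ) = φ`** — an exact right inverse that is LOCAL (block + cube
stencil), linear, and (Π-R♭-4, next) tent-smooth: the lift vanishes on every block face and the corrector has zero curl.

CONTENT ([folklore]; 0 sorry; ONE data def `smoothRightInverse`): §1 `Tcoarse_add'`, `iterate_Tcoarse_add`, `cpushIter_flat` (`= (Tcoarse L)^[j+1]`),
`iterate_Qcoarse_eq_linQIter`, `iterate_Qcoarse_apply`; §2 the definition and **THE END**.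

HONEST FRAMING.  Flat lattice kinematics of OUR objects; Bałaban's non-local minimiser `H` ([B9] Thm 3.12, (45)–(46)) is the TYPE this replaces at
`W = 1` only; the owner's SHAPE `SmoothLift` (Π-R) is NOT yet discharged (the four bounds are Π-R♭-4; curved `W` is Π-R-W); (P♮)_W, T-E_w and **NE3 are
NOT proved**; spine PROVED 0∕9; finite T⁴ rung (B)+1 — NOT infinite volume, NOT mass gap, NOT `BetaPertH`, NOT Clay.  PLACEMENT:
`Summits/QuantumFields/BalabanUV/`.  HONEST DEPENDENCY (cell page 1): continuum YM on T⁴ ⇐ BetaPertH ∧ nine spine estimates (0/9 proved); BetaPertH ⇐ (D1) ∧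
(D4) ∧ CAP+tail; G-an2-4 gates asym, D1 and NE2/3/4.
-/

set_option autoImplicit false

open scoped BigOperators Matrix.Norms.L2Operator
open Finset

namespace Summit.QuantumFields.BalabanUV.T4Continuum.NE3SmoothRightInverseFlat

open Literature.MathematicalPhysics.QuantumFieldTheory.Balaban1983to89
open B7Prop1Explicit B7Prop2Explicit
open B7Prop3Flat (linQ)
open B7Prop4Flat (linQIter linQIter_succ linQIter_eq_linQ_pow)
open AveragingDeficitMultiLevelPrep (cpush)
open AveragingDeficitChartCalculus (cavg)
open BlockAveragePushDirSplit (flat)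
open SmoothRefineNeutral (Tcoarse)
open SmoothRefineInterp (interp)
open NE3TangentNoGoWords (dPot)
open NE3TangentNoGoFlat (cpush_flat cavg_flat)
open NE3TangentFlatPush (Tside_add)
open NE3TangentFlatStructure (Qcoarse framePot iterate_Tcoarse_eq')
open NE3FramePotGauge (iterate_Tcoarse_dPot)
open NE3CoarseInterpolant (interp_corner)
open ReplicationRightInverse (cpushIter)
open NE3SmoothLiftFlat (smoothLift linQ_smoothLift)

noncomputable section

variable {d : ℕ} {n : Type*} [Fintype n] [DecidableEq n]

/-! ## §1 The tower at the flat background -/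

/-- The contour average read on the coarse lattice is additive. [folklore] -/
theorem Tcoarse_add' (L : ℕ) (A B : Site d → Fin d → Matrix n n ℂ) :
    Tcoarse L (A + B) = Tcoarse L A + Tcoarse L B := by
  funext z κ
  show SmoothRefineNeutral.Tcoarse L (A + B) z κ = _
  simp only [Tcoarse, Pi.add_apply, Tside_add]

/-- … and so is its `k`-fold iterate. [folklore] -/
theorem iterate_Tcoarse_add (L : ℕ) : ∀ (k : ℕ) (A B : Site d → Fin d → Matrix n n ℂ),
    (Tcoarse L)^[k] (A + B) = (Tcoarse L)^[k] A + (Tcoarse L)^[k] B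
  | 0, _, _ => rfl
  | k + 1, A, B => by
      rw [Function.iterate_succ_apply, Function.iterate_succ_apply, Function.iterate_succ_apply, Tcoarse_add', iterate_Tcoarse_add L k]

/-- **AT THE FLAT BACKGROUND THE `(j+1)`-FOLD PUSH-FORWARD IS THE `(j+1)`-FOLD ITERATED CONTOUR AVERAGE**:
`cpushIter L j 1 Y = (Tcoarse L)^[j+1] Y` (`L ≥ 1`; `cpush_flat`, `cavg_flat` along the tower). [folklore] -/
theorem cpushIter_flat {L : ℕ} (hL : 1 ≤ L) :
    ∀ (j : ℕ) (Y : Site d → Fin d → Matrix n n ℂ), cpushIter L j (flat (d := d) (n := n)) Y = (Tcoarse L)^[j + 1] Y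
  | 0, Y => by
      show cpush L flat Y = _
      rw [cpush_flat L hL]; rfl
  | j + 1, Y => by
      show cpushIter L j (cavg L flat) (cpush L flat Y) = _
      rw [cavg_flat, cpush_flat L hL, cpushIter_flat hL j, ← Function.iterate_succ_apply]

/-- The `k`-fold straight average is the composed linear part: `(Qcoarse L)^[k] Y = linQIter L Y k`. [folklore] -/
theorem iterate_Qcoarse_eq_linQIter (L : ℕ) : ∀ (k : ℕ) (Y : Site d → Fin d → Matrix n n ℂ), (Qcoarse L)^[k] Y = linQIter L Y k
  | 0, _ => rfl
  | k + 1, Y => by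
      rw [Function.iterate_succ_apply', iterate_Qcoarse_eq_linQIter L k Y]
      funext z κ
      rw [linQIter_succ]; rfl

/-- … hence the single-scale straight-line average over `L^k`-blocks (Literature `linQIter_eq_linQ_pow`). [folklore] -/
theorem iterate_Qcoarse_apply (L k : ℕ) (Y : Site d → Fin d → Matrix n n ℂ) (z : Site d) (κ : Fin d) :
    (Qcoarse L)^[k] Y z κ = linQ (L ^ k) Y (((L ^ k : ℕ) : ℤ) • z) κ := by
  rw [iterate_Qcoarse_eq_linQIter, linQIter_eq_linQ_pow]

/-! ## §2 The right inverse -/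

/-- **THE SMOOTH RIGHT INVERSE** of the `(j+1)`-fold linearised average at the flat background: the smooth lift at scale `M = L^{j+1}` plus the
curl-free pure-gauge corrector interpolating the lift's accumulated frame potential. [folklore] -/
def smoothRightInverse (L j : ℕ) (φ : Site d → Fin d → Matrix n n ℂ) : Site d → Fin d → Matrix n n ℂ :=
  smoothLift (L ^ (j + 1)) φ
    + dPot (interp (L ^ (j + 1)) Finset.univ (framePot L (j + 1) (smoothLift (L ^ (j + 1)) φ)))

/-- **EXACT RIGHT INVERSE**: `cpushIter L j 1 (smoothRightInverse L j φ) = φ` (`L ≥ 2`, any `j`, any coarse `φ`). [folklore] -/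
theorem cpushIter_flat_smoothRightInverse {L : ℕ} (hL : 2 ≤ L) (j : ℕ) (φ : Site d → Fin d → Matrix n n ℂ) :
    cpushIter L j (flat (d := d) (n := n)) (smoothRightInverse L j φ) = φ := by
  have hL1 : 1 ≤ L := by omega
  have hM1 : 1 ≤ L ^ (j + 1) := Nat.one_le_pow _ _ hL1
  have hM2 : 2 ≤ L ^ (j + 1) := by
    calc 2 ≤ L := hL
      _ = L ^ 1 := (pow_one L).symm
      _ ≤ L ^ (j + 1) := Nat.pow_le_pow_right (by omega) (by omega)
  set A := smoothLift (L ^ (j + 1)) φ with hA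
  set G := framePot L (j + 1) A with hG
  unfold smoothRightInverse
  rw [← hA, ← hG, cpushIter_flat hL1, iterate_Tcoarse_add, iterate_Tcoarse_eq' hL1 (j + 1) A, iterate_Tcoarse_dPot hL1 (j + 1)]
  funext z κ
  simp only [Pi.add_apply]
  -- the straight part reproduces `φ`
  have hQ : (Qcoarse L)^[j + 1] A z κ = φ z κ := by
    rw [iterate_Qcoarse_apply, hA, linQ_smoothLift hM2]
  -- the corrector's corner values are the frame potential
  have hcorner : (fun w => interp (L ^ (j + 1)) Finset.univ G (((L : ℤ) ^ (j + 1)) • w)) = G := by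
    funext w
    have h := interp_corner hM1 Finset.univ G w
    rwa [show (((L ^ (j + 1) : ℕ) : ℤ)) = (L : ℤ) ^ (j + 1) by push_cast; ring] at h
  rw [hQ, hcorner, ← hG, sub_add_cancel]

end

end Summit.QuantumFields.BalabanUV.T4Continuum.NE3SmoothRightInverseFlat
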